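import Literature.NumberTheory.Rogawski1990.StableConjugacyU3
import Mathlib.Algebra.Ring.Action.Basic
import Mathlib.GroupTheory.GroupAction.Defs
import HarnessLib

/-!
# The `F̄`-points model of a unitary group: `U(H)(K) ≅ GL_n(K)` with the TWISTED Galois action, whose fixed points are
# `U(H)(F)` (Rogawski 1990, §3.1, §14.2 — the carrier `G(F̄)` of stable conjugacy)

Topic `NumberTheory/Rogawski1990`; namespace `Literature.NumberTheory.Rogawski1990`.  DEFINITIONS WITH BODIES + proved theorems; no
named fact, no `sorry`, no instance (the action is a `def`, to be used with `letI`), no notation.  Companion of ★ `StableConjugacyU3`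
(stable conjugacy = `GL_n`-conjugacy) and ★ `GaloisCohomology/NonAbelianH1{,StableClasses}` (abstract `Γ`-group `A`, `A^Γ`,
`inv(γ, δ)`, `𝔇`): this file builds the `Γ`-group `A = G(F̄)` for `G = U(H)` and identifies `A^Γ` with `U(H)(F)`.

## The construction ([Rogawski1990, §1.9]: «Over `E`, `G` is isomorphic to the algebraic group defined by `D^*` … projection onto the
## first or second factors induces an isomorphism of `G_v` onto `D_w^*` … (these groups are isomorphic via `g → α(g)⁻¹`)», `D = M_n(E)`,
## `α(g) = Φ ᵗḡ Φ⁻¹`; §14.2 p. 232)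

Let `L/F` be quadratic with conjugation `c` (a CM field, `F = L⁺`), `H ∈ GL_n(L)` hermitian (`(c H)ᵀ = H`), and `K` an `L`-algebra
(`emb : L →+* K`; think `K = F̄ ⊇ L`) with a group `Γ` acting on `K` by ring automorphisms (`MulSemiringAction Γ K`) such that every
`τ ∈ Γ` restricts on `L` to the identity or to `c` — recorded by a hom `sign : Γ →* ℤˣ` (`CMTwist`).  Then `L ⊗_F K = K × K`,
`U(H)(K) = {(g₁, g₂) : g₂ᵀ H g₁ = H} ≅ GL_n(K)` by the first projection, and the Galois action of `τ` (through the second factor of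
`L ⊗_F K`) becomes, on `GL_n(K)`:  `τ ⋆ g = τ(g)` if `τ|_L = id`,  `τ ⋆ g = H⁻¹ (τ(g))⁻ᵀ H` if `τ|_L = c`  (`twistedAct`); it IS an
action by group automorphisms because `H` is hermitian (`twistedAct_mul`; `twistedAction : MulDistribMulAction Γ (GL n K)`, a `def`).
Fixed points: `τ(g) = g` for `τ ∈ ker sign` and `(c g)ᵀ H g = H`; so, granted `K^{ker sign} = emb(L)` (hypothesis `hfix` — Galois
theory of `K/L`, not proved here), `emb` injective and `sign` non-trivial, **`(GL_n(K))^Γ = U(H)(F)`** (`forall_twistedAct_eq_iff`): the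
inclusion `unitaryGroup c H ≤ GL_n(L) → GL_n(K)` lands in the fixed points (`twistedAct_embGL_of_mem_unitaryGroup`) and exhausts them.
Hence (pointers only): stable conjugacy in `U(H)(F)` (★ `IsStablyConj` = conjugacy in `GL_n(L)` = in `GL_n(K)`, ★
`isStablyConj_iff_isConj_map`) is conjugacy in the `Γ`-group `A = GL_n(K)`, and ★ `invClass` ∕ `kerH1` apply with this `A`.

NOT here: `K = F̄`, `Γ = Gal(F̄/F)` and the verification of `hfix` (infinite Galois theory); the tori of `U(3)`.
-/

noncomputable section

namespace Literature.NumberTheory.Rogawski1990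

open scoped MatrixGroups Matrix
open Literature.AlgebraicGeometry.ShimuraVarieties (unitaryGroup mem_unitaryGroup_iff)

/-! ## §1 `g ↦ gᵀ` and `g ↦ g⁻ᵀ` on `GL_n(K)` -/

section Transpose

variable {K : Type*} [CommRing K] {n : Type*} [Fintype n] [DecidableEq n]

/-- `↑(GL_n(f) g) = (↑g).map f`. [cite: Rogawski1990, §1.9] -/
theorem coe_generalLinearGroup_map {K' : Type*} [CommRing K'] (f : K →+* K') (g : GL n K) :
    ((Matrix.GeneralLinearGroup.map f g : GL n K') : Matrix n n K') = (g : Matrix n n K).map f := rfl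

/-- The transpose of an invertible matrix as an invertible matrix. [folklore] -/
def trUnit (g : GL n K) : GL n K where
  val := (g : Matrix n n K)ᵀ
  inv := ((g⁻¹ : GL n K) : Matrix n n K)ᵀ
  val_inv := by rw [← Matrix.transpose_mul, Units.inv_mul, Matrix.transpose_one]
  inv_val := by rw [← Matrix.transpose_mul, Units.mul_inv, Matrix.transpose_one]

/-- `↑(trUnit g) = (↑g)ᵀ`. [cite: Rogawski1990, §1.9] -/
@[simp] theorem coe_trUnit (g : GL n K) : (trUnit g : Matrix n n K) = (g : Matrix n n K)ᵀ := rfl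

/-- `(trUnit g)⁻¹ = trUnit g⁻¹`. [cite: Rogawski1990, §1.9] -/
theorem trUnit_inv (g : GL n K) : (trUnit g)⁻¹ = trUnit g⁻¹ := Units.ext rfl

/-- `trUnit` is an involution. [cite: Rogawski1990, §1.9] -/
@[simp] theorem trUnit_trUnit (g : GL n K) : trUnit (trUnit g) = g := Units.ext (Matrix.transpose_transpose _)

/-- `(g h)ᵀ = hᵀ gᵀ`. [cite: Rogawski1990, §1.9] -/
theorem trUnit_mul (g h : GL n K) : trUnit (g * h) = trUnit h * trUnit g :=
  Units.ext (by rw [coe_trUnit, Units.val_mul, Matrix.transpose_mul, Units.val_mul, coe_trUnit, coe_trUnit])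

/-- `1ᵀ = 1`. [cite: Rogawski1990, §1.9] -/
@[simp] theorem trUnit_one : trUnit (1 : GL n K) = 1 := Units.ext (by rw [coe_trUnit, Units.val_one, Matrix.transpose_one])

/-- **`g ↦ g⁻ᵀ = (g⁻¹)ᵀ`**, a group endomorphism of `GL_n(K)`. [folklore] -/
def invTranspose : GL n K →* GL n K where
  toFun g := trUnit g⁻¹
  map_one' := by rw [inv_one, trUnit_one]
  map_mul' g h := by rw [mul_inv_rev, trUnit_mul]

/-- `invTranspose g = trUnit g⁻¹`. [cite: Rogawski1990, §1.9] -/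
theorem invTranspose_apply (g : GL n K) : invTranspose g = trUnit g⁻¹ := rfl

/-- `invTranspose g = (trUnit g)⁻¹`. [cite: Rogawski1990, §1.9] -/
theorem invTranspose_eq_trUnit_inv (g : GL n K) : invTranspose g = (trUnit g)⁻¹ := by rw [invTranspose_apply, trUnit_inv]

/-- `↑(invTranspose g) = (↑g⁻¹)ᵀ`. [cite: Rogawski1990, §1.9] -/
@[simp] theorem coe_invTranspose (g : GL n K) : (invTranspose g : Matrix n n K) = ((g⁻¹ : GL n K) : Matrix n n K)ᵀ := rfl

/-- `invTranspose` is an involution. [cite: Rogawski1990, §1.9] -/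
@[simp] theorem invTranspose_invTranspose (g : GL n K) : invTranspose (invTranspose g) = g := by
  rw [invTranspose_eq_trUnit_inv, invTranspose_eq_trUnit_inv, ← trUnit_inv (trUnit g), inv_inv, trUnit_trUnit]

/-- `invTranspose (trUnit g) = g⁻¹`. [cite: Rogawski1990, §1.9] -/
theorem invTranspose_trUnit (g : GL n K) : invTranspose (trUnit g) = g⁻¹ := by
  rw [invTranspose_apply, ← trUnit_inv, trUnit_trUnit]

/-- Ring homomorphisms commute with `trUnit`. [cite: Rogawski1990, §1.9] -/
theorem map_trUnit {K' : Type*} [CommRing K'] (f : K →+* K') (g : GL n K) :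
    Matrix.GeneralLinearGroup.map f (trUnit g) = trUnit (Matrix.GeneralLinearGroup.map f g) :=
  Units.ext (by rw [coe_generalLinearGroup_map, coe_trUnit, coe_trUnit, coe_generalLinearGroup_map, Matrix.transpose_map])

/-- Ring homomorphisms commute with `invTranspose`. [cite: Rogawski1990, §1.9] -/
theorem map_invTranspose {K' : Type*} [CommRing K'] (f : K →+* K') (g : GL n K) :
    Matrix.GeneralLinearGroup.map f (invTranspose g) = invTranspose (Matrix.GeneralLinearGroup.map f g) := by
  rw [invTranspose_apply, invTranspose_apply, map_trUnit, map_inv]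

/-! ## §2 The hermitian twist `θ_H : g ↦ H⁻¹ g⁻ᵀ H` -/

/-- **`θ_H g = H⁻¹ g⁻ᵀ H`** — the involution of `GL_n(K)` through which the conjugation of `L/F` acts on `U(H)(K) ≅ GL_n(K)`
(Rogawski's `g ↦ α(g)⁻¹`, `α(g) = Φ ᵗḡ Φ⁻¹`, up to the order convention of `unitaryGroup`). [cite: Rogawski1990, §1.9] -/
def hermTwist (HK : GL n K) : GL n K →* GL n K :=
  (MulAut.conj HK⁻¹).toMonoidHom.comp invTranspose

/-- `θ_H g = H⁻¹ g⁻ᵀ H`. [cite: Rogawski1990, §1.9] -/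
theorem hermTwist_apply (HK g : GL n K) : hermTwist HK g = HK⁻¹ * invTranspose g * HK := by
  rw [hermTwist, MonoidHom.comp_apply, MulEquiv.toMonoidHom_eq_coe, MonoidHom.coe_coe, MulAut.conj_apply, inv_inv]

/-- `θ_{Hᵀ} (θ_H g) = g` — the identity behind «the twisted action IS an action» for hermitian `H` (`c(H) = Hᵀ`). [cite: Rogawski1990, §1.9] -/
theorem hermTwist_trUnit_hermTwist (HK g : GL n K) : hermTwist (trUnit HK) (hermTwist HK g) = g := by
  rw [hermTwist_apply, hermTwist_apply, map_mul, map_mul, map_inv, invTranspose_invTranspose, invTranspose_eq_trUnit_inv HK]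
  group

/-- `θ_H (θ_{Hᵀ} g) = g`. [cite: Rogawski1990, §1.9] -/
theorem hermTwist_hermTwist_trUnit (HK g : GL n K) : hermTwist HK (hermTwist (trUnit HK) g) = g := by
  have h := hermTwist_trUnit_hermTwist (trUnit HK) g
  rwa [trUnit_trUnit] at h

end Transpose

/-! ## §3 The Galois action on `GL_n(K)` and the twist datum of a CM (quadratic) extension -/

section Galois

variable {K : Type*} [CommRing K] {n : Type*} [Fintype n] [DecidableEq n] (Γ : Type*) [Group Γ] [MulSemiringAction Γ K]

/-- The entrywise action of `τ ∈ Γ` on `GL_n(K)` (a group automorphism). [folklore] -/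
def galActGL (τ : Γ) : GL n K →* GL n K := Matrix.GeneralLinearGroup.map (MulSemiringAction.toRingHom Γ K τ)

/-- `(τ ⋅ g) i j = τ • g i j`. [cite: Rogawski1990, §1.9] -/
@[simp] theorem galActGL_apply_coe (τ : Γ) (g : GL n K) (i j : n) :
    (galActGL Γ τ g : Matrix n n K) i j = τ • (g : Matrix n n K) i j := rfl

/-- `1 ∈ Γ` acts trivially. [cite: Rogawski1990, §1.9] -/
theorem galActGL_one (g : GL n K) : galActGL Γ (1 : Γ) g = g :=
  Units.ext (by ext i j; rw [galActGL_apply_coe, one_smul])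

/-- `(τ₁ τ₂) ⋅ g = τ₁ ⋅ (τ₂ ⋅ g)`. [cite: Rogawski1990, §1.9] -/
theorem galActGL_mul (τ₁ τ₂ : Γ) (g : GL n K) : galActGL Γ (τ₁ * τ₂) g = galActGL Γ τ₁ (galActGL Γ τ₂ g) :=
  Units.ext (by ext i j; rw [galActGL_apply_coe, galActGL_apply_coe, galActGL_apply_coe, mul_smul])

/-- The Galois action commutes with `invTranspose`. [cite: Rogawski1990, §1.9] -/
theorem galActGL_invTranspose (τ : Γ) (g : GL n K) : galActGL Γ τ (invTranspose g) = invTranspose (galActGL Γ τ g) :=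
  map_invTranspose _ g

/-- `τ ⋅ θ_H(g) = θ_{τH}(τ ⋅ g)`. [cite: Rogawski1990, §1.9] -/
theorem galActGL_hermTwist (τ : Γ) (HK g : GL n K) :
    galActGL Γ τ (hermTwist HK g) = hermTwist (galActGL Γ τ HK) (galActGL Γ τ g) := by
  rw [hermTwist_apply, hermTwist_apply, map_mul, map_mul, map_inv, galActGL_invTranspose]

variable (K) in
/-- **Twist datum of a quadratic (CM) extension acting through `K`**: `emb : L →+* K` (structure map of the `L`-algebra `K`, e.g.
`K = F̄`), the conjugation `conj` of `L/F`, and `sign : Γ →* ℤˣ` recording whether `τ ∈ Γ` restricts on `L` to the identity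
(`sign τ = 1`) or to `conj` (`sign τ = -1`) — «`E/F` a quadratic extension and `σ` the conjugation of `E` with respect to `F`»,
acting through the second factor of `E ⊗_F K`. [cite: Rogawski1990, §1.9] -/
structure CMTwist (L : Type*) [CommRing L] where
  /-- the structure map `L → K` -/
  emb : L →+* K
  /-- the conjugation of `L/F` -/
  conj : L →+* L
  /-- restriction of `τ` to `L`: `1` ↦ identity, `-1` ↦ `conj` -/
  sign : Γ →* ℤˣ
  /-- `τ|_L = id` when `sign τ = 1` -/
  smul_emb_of_sign_eq_one : ∀ τ : Γ, sign τ = 1 → ∀ x : L, τ • emb x = emb x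
  /-- `τ|_L = conj` when `sign τ = -1` -/
  smul_emb_of_sign_eq_neg_one : ∀ τ : Γ, sign τ = -1 → ∀ x : L, τ • emb x = emb (conj x)

variable {Γ} {L : Type*} [CommRing L] (D : CMTwist K Γ L) (H : GL n L)

/-- `emb` on `GL_n`: `GL_n(L) → GL_n(K)`. [folklore] -/
def CMTwist.embGL : GL n L →* GL n K := Matrix.GeneralLinearGroup.map D.emb

/-- `↑(embGL g) = (↑g).map emb`. [cite: Rogawski1990, §1.9] -/
theorem CMTwist.coe_embGL (g : GL n L) : (D.embGL g : Matrix n n K) = (g : Matrix n n L).map D.emb := rfl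

/-- `embGL` commutes with `trUnit`. [cite: Rogawski1990, §1.9] -/
theorem CMTwist.embGL_trUnit (g : GL n L) : D.embGL (trUnit g) = trUnit (D.embGL g) := map_trUnit D.emb g

/-- `τ ⋅ emb(g) = emb(g)` when `τ|_L = id`. [cite: Rogawski1990, §1.9] -/
theorem CMTwist.galActGL_embGL_of_sign_eq_one {τ : Γ} (hτ : D.sign τ = 1) (g : GL n L) :
    galActGL Γ τ (D.embGL g) = D.embGL g :=
  Units.ext (by ext i j; rw [galActGL_apply_coe, CMTwist.coe_embGL, Matrix.map_apply, D.smul_emb_of_sign_eq_one τ hτ])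

/-- `τ ⋅ emb(g) = emb(conj g)` when `τ|_L = conj`. [cite: Rogawski1990, §1.9] -/
theorem CMTwist.galActGL_embGL_of_sign_eq_neg_one {τ : Γ} (hτ : D.sign τ = -1) (g : GL n L) :
    galActGL Γ τ (D.embGL g) = D.embGL (Matrix.GeneralLinearGroup.map D.conj g) :=
  Units.ext (by
    ext i j
    rw [galActGL_apply_coe, CMTwist.coe_embGL, CMTwist.coe_embGL, coe_generalLinearGroup_map, Matrix.map_apply, Matrix.map_apply,
      Matrix.map_apply, D.smul_emb_of_sign_eq_neg_one τ hτ])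

/-- For HERMITIAN `H` (`(conj H)ᵀ = H`): `conj` applied entrywise to `H` is `Hᵀ`. [cite: Rogawski1990, §1.9] -/
theorem map_conj_eq_trUnit_of_hermitian (hH : ((H : Matrix n n L).map D.conj)ᵀ = (H : Matrix n n L)) :
    Matrix.GeneralLinearGroup.map D.conj H = trUnit H :=
  Units.ext (by rw [coe_generalLinearGroup_map, coe_trUnit, ← hH, Matrix.transpose_transpose, hH])

/-- For hermitian `H`: `τ ⋅ H_K = (H_K)ᵀ` when `τ|_L = conj`. [cite: Rogawski1990, §1.9] -/
theorem CMTwist.galActGL_embGL_of_hermitian {τ : Γ} (hτ : D.sign τ = -1)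
    (hH : ((H : Matrix n n L).map D.conj)ᵀ = (H : Matrix n n L)) :
    galActGL Γ τ (D.embGL H) = trUnit (D.embGL H) := by
  rw [D.galActGL_embGL_of_sign_eq_neg_one hτ, map_conj_eq_trUnit_of_hermitian D H hH, D.embGL_trUnit]

/-! ## §4 The twisted action -/

/-- **The twisted action of `τ ∈ Γ` on `U(H)(K) ≅ GL_n(K)`**: `τ ⋆ g = τ ⋅ g` if `τ|_L = id`, `= H_K⁻¹ (τ ⋅ g)⁻ᵀ H_K` if
`τ|_L = conj` (each a group automorphism of `GL_n(K)`). [cite: Rogawski1990, §14.2 p. 232] -/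
def twistedAct (τ : Γ) : GL n K →* GL n K :=
  if D.sign τ = 1 then galActGL Γ τ else (hermTwist (D.embGL H)).comp (galActGL Γ τ)

/-- `τ ⋆ g = τ ⋅ g` for `τ|_L = id`. [cite: Rogawski1990, §14.2 p. 232] -/
theorem twistedAct_of_sign_eq_one {τ : Γ} (hτ : D.sign τ = 1) (g : GL n K) : twistedAct D H τ g = galActGL Γ τ g := by
  rw [twistedAct, if_pos hτ]

/-- `τ ⋆ g = H_K⁻¹ (τ ⋅ g)⁻ᵀ H_K` for `τ|_L = conj`. [cite: Rogawski1990, §14.2 p. 232] -/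
theorem twistedAct_of_sign_eq_neg_one {τ : Γ} (hτ : D.sign τ = -1) (g : GL n K) :
    twistedAct D H τ g = hermTwist (D.embGL H) (galActGL Γ τ g) := by
  have h1 : D.sign τ ≠ 1 := by rw [hτ]; decide
  rw [twistedAct, if_neg h1, MonoidHom.comp_apply]

/-- `1 ⋆ g = g`. [cite: Rogawski1990, §1.9] -/
theorem twistedAct_one (g : GL n K) : twistedAct D H 1 g = g := by
  rw [twistedAct_of_sign_eq_one D H (map_one D.sign), galActGL_one]

/-- **`(τ₁τ₂) ⋆ g = τ₁ ⋆ (τ₂ ⋆ g)`** — uses that `H` is hermitian (`θ_H θ_{Hᵀ} = id`). [cite: Rogawski1990, §1.9] -/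
theorem twistedAct_mul (hH : ((H : Matrix n n L).map D.conj)ᵀ = (H : Matrix n n L)) (τ₁ τ₂ : Γ) (g : GL n K) :
    twistedAct D H (τ₁ * τ₂) g = twistedAct D H τ₁ (twistedAct D H τ₂ g) := by
  have hs : D.sign (τ₁ * τ₂) = D.sign τ₁ * D.sign τ₂ := map_mul _ _ _
  rcases Int.units_eq_one_or (D.sign τ₁) with h₁ | h₁ <;> rcases Int.units_eq_one_or (D.sign τ₂) with h₂ | h₂
  · rw [twistedAct_of_sign_eq_one D H (by rw [hs, h₁, h₂, one_mul]), twistedAct_of_sign_eq_one D H h₁,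
      twistedAct_of_sign_eq_one D H h₂, galActGL_mul]
  · rw [twistedAct_of_sign_eq_neg_one D H (by rw [hs, h₁, h₂, one_mul]), twistedAct_of_sign_eq_one D H h₁,
      twistedAct_of_sign_eq_neg_one D H h₂, galActGL_hermTwist, D.galActGL_embGL_of_sign_eq_one h₁, galActGL_mul]
  · rw [twistedAct_of_sign_eq_neg_one D H (by rw [hs, h₁, h₂, mul_one]), twistedAct_of_sign_eq_neg_one D H h₁,
      twistedAct_of_sign_eq_one D H h₂, galActGL_mul]
  · rw [twistedAct_of_sign_eq_one D H (by rw [hs, h₁, h₂]; decide), twistedAct_of_sign_eq_neg_one D H h₁,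
      twistedAct_of_sign_eq_neg_one D H h₂, galActGL_hermTwist, D.galActGL_embGL_of_hermitian H h₁ hH, galActGL_mul,
      hermTwist_hermTwist_trUnit]

/-- **The twisted action as a `MulDistribMulAction` of `Γ` on `GL_n(K)`** (a `def`, not an instance: use `letI`). This is the
`Γ`-group `A = G(F̄)` of ★ `GaloisCohomology/NonAbelianH1StableClasses` for `G = U(H)`. [cite: Rogawski1990, §3.1 p. 19] -/
@[reducible] def twistedAction (hH : ((H : Matrix n n L).map D.conj)ᵀ = (H : Matrix n n L)) : MulDistribMulAction Γ (GL n K) where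
  smul τ g := twistedAct D H τ g
  one_smul g := twistedAct_one D H g
  mul_smul τ₁ τ₂ g := twistedAct_mul D H hH τ₁ τ₂ g
  smul_mul τ g h := map_mul (twistedAct D H τ) g h
  smul_one τ := map_one (twistedAct D H τ)

/-- Unfolding the twisted action. [cite: Rogawski1990, §1.9] -/
theorem twistedAction_smul (hH : ((H : Matrix n n L).map D.conj)ᵀ = (H : Matrix n n L)) (τ : Γ) (g : GL n K) :
    (letI := twistedAction D H hH; τ • g) = twistedAct D H τ g := rfl

/-- **`U(H)(F) → GL_n(K)` lands in the fixed points of the twisted action**: for `g₀ ∈ unitaryGroup conj H ≤ GL_n(L)`,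
`τ ⋆ emb(g₀) = emb(g₀)` for every `τ`. [cite: Rogawski1990, §3.1 p. 19] -/
theorem twistedAct_embGL_of_mem_unitaryGroup {g₀ : GL n L} (hg₀ : g₀ ∈ unitaryGroup D.conj (H : Matrix n n L)) (τ : Γ) :
    twistedAct D H τ (D.embGL g₀) = D.embGL g₀ := by
  rcases Int.units_eq_one_or (D.sign τ) with h | h
  · rw [twistedAct_of_sign_eq_one D H h, D.galActGL_embGL_of_sign_eq_one h]
  · rw [twistedAct_of_sign_eq_neg_one D H h, D.galActGL_embGL_of_sign_eq_neg_one h, hermTwist_apply]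
    -- unitarity `(conj g₀)ᵀ H g₀ = H` in `GL_n(L)`, pushed to `GL_n(K)`
    rw [mem_unitaryGroup_iff] at hg₀
    have hu : trUnit (Matrix.GeneralLinearGroup.map D.conj g₀) * H * g₀ = H :=
      Units.ext (by rw [Units.val_mul, Units.val_mul, coe_trUnit, coe_generalLinearGroup_map]; exact hg₀)
    have huK : trUnit (D.embGL (Matrix.GeneralLinearGroup.map D.conj g₀)) * D.embGL H * D.embGL g₀ = D.embGL H := by
      rw [← D.embGL_trUnit, ← map_mul, ← map_mul, hu]
    rw [invTranspose_eq_trUnit_inv]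
    calc (D.embGL H)⁻¹ * (trUnit (D.embGL (Matrix.GeneralLinearGroup.map D.conj g₀)))⁻¹ * D.embGL H
        = (D.embGL H)⁻¹ * (trUnit (D.embGL (Matrix.GeneralLinearGroup.map D.conj g₀)))⁻¹ *
            (trUnit (D.embGL (Matrix.GeneralLinearGroup.map D.conj g₀)) * D.embGL H * D.embGL g₀) := by rw [huK]
      _ = D.embGL g₀ := by group

end Galois

/-! ## §5 Fixed points = `U(H)(F)`, granted `K^{ker sign} = L` -/

section FixedPoints

variable {K : Type*} [CommRing K] {n : Type*} [Fintype n] [DecidableEq n] {Γ : Type*} [Group Γ] [MulSemiringAction Γ K]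
  {L : Type*} [CommRing L] (D : CMTwist K Γ L) (H : GL n L)
  (hinj : Function.Injective D.emb)
  (hfix : ∀ x : K, (∀ τ : Γ, D.sign τ = 1 → τ • x = x) → x ∈ Set.range D.emb)
  (hc : ∃ τ : Γ, D.sign τ = -1)

omit [Fintype n] [DecidableEq n] in
include hinj in
/-- `M ↦ M.map emb` is injective on matrices when `emb` is. [cite: Rogawski1990, §1.9] -/
theorem CMTwist.map_emb_injective : Function.Injective fun M : Matrix n n L => M.map D.emb := by
  intro A B h
  ext i j
  exact hinj (congr_fun (congr_fun h i) j)

include hfix in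
/-- An element of `GL_n(K)` fixed entrywise by `ker sign` comes from a matrix over `L`. [cite: Rogawski1990, §1.9] -/
theorem CMTwist.exists_map_eq_of_forall_galActGL_eq (u : GL n K) (hu : ∀ τ : Γ, D.sign τ = 1 → galActGL Γ τ u = u) :
    ∃ m : Matrix n n L, m.map D.emb = (u : Matrix n n K) := by
  have h : ∀ i j, ∃ y : L, D.emb y = (u : Matrix n n K) i j := fun i j =>
    hfix _ fun τ hτ => by
      have e := congrArg (fun v : GL n K => (v : Matrix n n K) i j) (hu τ hτ)
      simpa only [galActGL_apply_coe] using e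
  choose m hm using h
  exact ⟨Matrix.of fun i j => m i j, by ext i j; rw [Matrix.map_apply, Matrix.of_apply, hm]⟩

include hinj hfix hc in
/-- **`(GL_n(K))^Γ = U(H)(F)`**: `g ∈ GL_n(K)` is fixed by the twisted action iff `g = emb(g₀)` for a (unique) `g₀ ∈ unitaryGroup conj H
≤ GL_n(L)` — granted `K^{ker sign} = emb(L)` (`hfix`), `emb` injective (`hinj`), and some `τ` restricting to the conjugation (`hc`).
[cite: Rogawski1990, §3.1 p. 19] -/
theorem forall_twistedAct_eq_iff (g : GL n K) :
    (∀ τ : Γ, twistedAct D H τ g = g) ↔ ∃ g₀ : GL n L, g₀ ∈ unitaryGroup D.conj (H : Matrix n n L) ∧ D.embGL g₀ = g := by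
  constructor
  · intro hg
    have hg1 : ∀ τ : Γ, D.sign τ = 1 → galActGL Γ τ g = g := fun τ hτ => by
      rw [← twistedAct_of_sign_eq_one D H hτ]; exact hg τ
    have hg1' : ∀ τ : Γ, D.sign τ = 1 → galActGL Γ τ g⁻¹ = g⁻¹ := fun τ hτ => by rw [map_inv, hg1 τ hτ]
    obtain ⟨m, hm⟩ := D.exists_map_eq_of_forall_galActGL_eq hfix g hg1
    obtain ⟨m', hm'⟩ := D.exists_map_eq_of_forall_galActGL_eq hfix g⁻¹ hg1'
    have h10 : ∀ (f : L →+* K), (1 : Matrix n n L).map f = 1 := fun f => Matrix.map_one f (map_zero f) (map_one f)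
    have hmm' : m * m' = 1 := D.map_emb_injective hinj (by
      change (m * m').map D.emb = (1 : Matrix n n L).map D.emb
      rw [Matrix.map_mul, hm, hm', h10, ← Units.val_mul, mul_inv_cancel, Units.val_one])
    have hm'm : m' * m = 1 := D.map_emb_injective hinj (by
      change (m' * m).map D.emb = (1 : Matrix n n L).map D.emb
      rw [Matrix.map_mul, hm, hm', h10, ← Units.val_mul, inv_mul_cancel, Units.val_one])
    let g₀ : GL n L := ⟨m, m', hmm', hm'm⟩
    have hg₀ : D.embGL g₀ = g := Units.ext hm
    refine ⟨g₀, ?_, hg₀⟩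
    -- unitarity from the twisted invariance under a `τ` restricting to `conj`
    obtain ⟨τ, hτ⟩ := hc
    have key := hg τ
    rw [twistedAct_of_sign_eq_neg_one D H hτ, ← hg₀, D.galActGL_embGL_of_sign_eq_neg_one hτ, hermTwist_apply,
      invTranspose_eq_trUnit_inv] at key
    -- key : H_K⁻¹ (ᵗX)⁻¹ H_K = emb g₀ with X = emb (conj g₀); hence ᵗX H_K emb(g₀) = H_K
    have key' : trUnit (D.embGL (Matrix.GeneralLinearGroup.map D.conj g₀)) * D.embGL H * D.embGL g₀ = D.embGL H := by
      calc trUnit (D.embGL (Matrix.GeneralLinearGroup.map D.conj g₀)) * D.embGL H * D.embGL g₀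
          = trUnit (D.embGL (Matrix.GeneralLinearGroup.map D.conj g₀)) * D.embGL H *
              ((D.embGL H)⁻¹ * (trUnit (D.embGL (Matrix.GeneralLinearGroup.map D.conj g₀)))⁻¹ * D.embGL H) := by rw [key]
        _ = D.embGL H := by group
    rw [← D.embGL_trUnit, ← map_mul, ← map_mul] at key'
    have key'' := congrArg (fun u : GL n K => (u : Matrix n n K)) key'
    simp only [CMTwist.coe_embGL, Units.val_mul, coe_trUnit, coe_generalLinearGroup_map, Matrix.map_mul,
      Matrix.transpose_map] at key''
    rw [mem_unitaryGroup_iff]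
    refine D.map_emb_injective hinj ?_
    change ((((g₀ : GL n L) : Matrix n n L).map D.conj)ᵀ * (H : Matrix n n L) * (g₀ : Matrix n n L)).map D.emb =
      ((H : GL n L) : Matrix n n L).map D.emb
    rw [Matrix.map_mul, Matrix.map_mul, Matrix.transpose_map]
    exact key''
  · rintro ⟨g₀, hg₀, rfl⟩ τ
    exact twistedAct_embGL_of_mem_unitaryGroup D H hg₀ τ

include hinj hfix hc in
/-- The same in `FixedPoints.subgroup` form for the `MulDistribMulAction` `twistedAction` (hermitian `H`): the fixed subgroup
`(GL_n(K))^Γ` is the image of `U(H)(F) = unitaryGroup conj H` under `embGL`. [cite: Rogawski1990, §3.1 p. 19] -/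
theorem mem_fixedPoints_twistedAction_iff (hH : ((H : Matrix n n L).map D.conj)ᵀ = (H : Matrix n n L)) (g : GL n K) :
    (letI := twistedAction D H hH; g ∈ FixedPoints.subgroup Γ (GL n K)) ↔
      ∃ g₀ : GL n L, g₀ ∈ unitaryGroup D.conj (H : Matrix n n L) ∧ D.embGL g₀ = g := by
  letI := twistedAction D H hH
  rw [FixedPoints.mem_subgroup]
  exact forall_twistedAct_eq_iff D H hinj hfix hc g

end FixedPoints

end Literature.NumberTheory.Rogawski1990
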